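import Summits.QuantumFields.YangMills.Theorems.AlphaInputsT3ACv3ProfileRegionR3
import Summits.QuantumFields.YangMills.Theorems.AlphaInputsT3ACv3XsClassSelector
import HarnessLib

/-!
# `AlphaInputsT3ACv3ChargedGlueXs` — THE FREE-SEAM GLUE IN ONE CURRENCY: ★alpha-2's glue theorem for `𝒞_X` (`…v3ChargedGlueX`) moved to the one-currency class
# `𝒞_Xs(k, h, W)` (`adaptedClassT3Xs`, recording-currency (67) conjunct `large67RecSet`), and the KNIT with the measurable selector (`…v3XsClassSelector`):
# ★★★ `InClassSelT3Xs ⇐ (EL) inner exact lifts + outer parts read in BOTH currencies` — cell `ym3-torus`, crux stmt-QuantumFields-19936 (`HistoryTailL`, line v5p10),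
# width seat ym-ust-19936-w5 (g4); LEAD ★w1-19936 g3 ruling (R1) (door of record = Sel∕Xs)

WHY.  After (R1) the 19936 residue reads `{T8} ∪ {DataRowsT3XsChiSel}`, and `DataRowsT3XsChiSel K Ut := ∃ UkH, InClassSelT3Xs K Ut UkH ∧ ⟨NODE O's data rows for UkH⟩`.
✓ `exists_inClassSelT3Xs_of_nonempty_univ` (this seat, p623120) turns the selection conjunct into the KINEMATIC row «`𝒞_Xs(k, h, W) ≠ ∅` at every admissible non-trivial
`(k, h, W)`».  For the comb-currency class `𝒞_X` that row is ★alpha-2 g4's FREE-SEAM GLUE ✓ `glue_mem_adaptedClassT3X` (inner lift of `W` on `Ω_k(h)` ⊕ outer part off it; every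
conjunct reads ONE read region) + the enlarged-region profile.  `𝒞_Xs` differs from `𝒞_X` in ONE conjunct: (67)-largeness at the recorded plaquettes is read on the SYMMETRIC
`(blockAvg ℰp)^j`-average (`large67RecSet`) instead of the comb average (`large67Set`).  THIS FILE (def-free):
* §1 ★ `glue_mem_large67RecSet` — at an admissible history the recording-currency (67) set reads the glue through `U_out` (a recorded `p ∈ P_j(h)` is a read plaquette of `Λ_j(h)`,
  ✓ `mem_plaqsIn_lam42_of_mem_hist`, so the per-region glue lemma ✓ `plaqHol_iter_eq_of_eqOn_region` applies at `i = s = j`);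
* §2 ★★ `glue_mem_adaptedClassT3Xs` — inner lift ⊕ (outer part ∧ `U_out ∈ large67RecSet`) ∈ `𝒞_Xs(k, h, W)`;
* §3 `adaptedClassT3Xs_nonempty_of_parts` — per `(k, h, W)`: charged ⇒ the glue; uncharged ⇒ the outer part itself (given its global seam-blind small loops);
* §4 ★★★ `exists_inClassSelT3Xs_of_innerLift_of_outerPartsRec` — for a measurable trivial-history family `Ut`: (EL) `InnerExactLiftT3` + (OPR) «at every admissible non-trivial
  `(k, h)` some `U` is an outer part, lies in `localSmallT3X`, and in `large67RecSet`» ⟹ `∃ UkH, InClassSelT3Xs F 𝔠 γ hγ hγ1 K Ut UkH ∧` (argmin of the Wilson action over `𝒞_Xs`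
  at every admissible non-trivial `(k, h, W)`).  Suppliers of record: (EL) ⇐ ✓ `innerExactLiftT3_of_fineLifts_of_sizes` ⇐ the (FL)∕M22 chain; (OPR)'s comb∕(68)∕small-loop parts ⇐
  ✓ `outerPartT3_profE_of_collar` + the core chain; (OPR)'s recording-currency part `profE ∈ large67RecSet` = ★w4-19936 g4∕g5's located row (U2) (the `blockAvg ℰp` abelian twin of
  ✓ `avgIter_abelCfg`), DISPLAYED here;
* §5 `outerPartsRec_of_collar_of_profRec` — (OPR) from the enlarged-region profile `profE` under the collar row (N2′) `CollarE … K` and `4π ≤ C68` (✓ `outerPartT3_profE_of_collar`,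
  ✓ `profileReg68LevelsT3_of_collar`, ✓ `profE_mem_localSmallT3_of_collar`) MODULO the displayed row (U2) «`profE ∈ large67RecSet` at every admissible history»; ★★★
  `exists_inClassSelT3Xs_of_innerLift_of_collar_of_profRec` — the selection row from (EL) + (N2′) + `4π ≤ C68` + (U2).
HONEST FRAMING.  Kinematics only (gluing, locality, selection); the selected argmin is NOT claimed to be print's (42)-minimiser and its interiority is NOT claimed (NODE O rows 22–23
for that map); (EL) and (OPR) are HYPOTHESES of §4.  Nothing of [Balaban1985UV3]∕[Balaban1985Variational]'s estimates is asserted; the stub 2′χ, the crux `HistoryTailL`, T8 and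
any gap are NOT claimed; count-neutral helper (`--supports stmt-QuantumFields-19936`); registry untouched.  YM₃ on the three-torus is rung R3 of the programme, NOT the Clay
problem (no bearing on d = 4, infinite volume, or a mass gap).

References: T. Bałaban, Commun. Math. Phys. 102 (1985) 255–275 [Balaban1985UV3] ((42) p.266, (67)–(68) p.273, p.273 L14); Commun. Math. Phys. 102 (1985) 277–309
[Balaban1985Variational] (Sect. A (11)–(13) pp.279–280, Thm 1 (8) p.279); Commun. Math. Phys. 98 (1985) 17–51 [Balaban1985Averaging] (p.24).
-/

set_option autoImplicit false

noncomputable section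

namespace Summit.QuantumFields.YangMills.Theorems

open MeasureTheory Set
open scoped Matrix Matrix.Norms.L2Operator
open Literature.MathematicalPhysics.QuantumFieldTheory.Balaban1983to89
open Literature.MathematicalPhysics.QuantumFieldTheory.Balaban1983to89.T3ContinuumYM3Torus
open Literature.MathematicalPhysics.QuantumFieldTheory.Balaban1983to89.T3UnitLawDensityEML (ℰp)
open Literature.MathematicalPhysics.QuantumFieldTheory.Balaban1983to89.T3UnitScaleTilt (θBal)
open Literature.MathematicalPhysics.QuantumFieldTheory.Balaban1983to89.B10Eq38TorusDomains (plaqsIn)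
open Literature.MathematicalPhysics.QuantumFieldTheory.Balaban1983to89.B10Eq42TorusConstraint (bondsIn lam42 lam42_self lam42_of_lt)
open Literature.MathematicalPhysics.QuantumFieldTheory.Balaban1985CMP102.Setting
open Summit.QuantumFields.Balaban3D.Carriers
open Summit.QuantumFields.Balaban3D.Proofs.Primitives (AlphaConsts)
open Summit.QuantumFields.YangMills.Theorems.ProfileEnlarged (CollarE profE)

section T3

variable {F : T3Family} {𝔠 : AlphaConsts F.L (suGroupModel 2).N} {γ : ℝ} {hγ : 0 < γ} {hγ1 : γ ≤ (min 𝔠.gamma0 1) ^ 2} {K : ℕ}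

/-! ## §1 The recording-currency (67) set reads the glue through `U_out` -/

/-- ★ **THE RECORDING-CURRENCY (67)-LARGENESS SET READS THE GLUE THROUGH `U_out`** (admissible `h`, `k ≤ K`): a recorded plaquette `p ∈ P_j(h)`, `j < k`, lies in
`plaqsIn j (Λ_j(h))` (`mem_plaqsIn_lam42_of_mem_hist`), the glue is `U_out` on the fine bonds of `Λ_j(h)` (`glueT3_eq_out`), and the `j`-fold `ℰp`-averaged plaquette variable at
`p` reads only those bonds (`plaqHol_iter_eq_of_eqOn_region`). [cite: Balaban1985UV3, (67) p.273 and p.273 L14; Balaban1985Averaging, p.24] -/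
theorem AlphaInputsT3AC.glue_mem_large67RecSet {k : ℕ} (hk : k ≤ K) {h : Hist (F.P K) k}
    (hh : Hist.Admissible 𝔠.lane.carrier.M₁ (rcolOf (T3Scales F γ hγ (hγ1.trans (sq_min_one_le _ 𝔠.gamma0_pos)) K) 𝔠.lane.carrier) k h)
    {U_in U_out : GaugeField (F.P K) 0 (Matrix.specialUnitaryGroup (Fin 2) ℂ)} (hout : U_out ∈ AlphaInputsT3AC.large67RecSet F 𝔠 γ hγ hγ1 K k h) :
    AlphaInputsT3AC.glueT3 F 𝔠 γ hγ hγ1 K k h U_in U_out ∈ AlphaInputsT3AC.large67RecSet F 𝔠 γ hγ hγ1 K k h := by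
  intro j p hp
  have hq := AlphaInputsT3AC.mem_plaqsIn_lam42_of_mem_hist (𝔠 := 𝔠) (hγ := hγ) (hγ1 := hγ1) hk hh j hp
  rw [AlphaInputsT3AC.plaqHol_iter_eq_of_eqOn_region (hγ1 := hγ1) hk h (le_of_lt j.isLt)
    (fun b hb => AlphaInputsT3AC.glueT3_eq_out (hγ1 := hγ1) U_in U_out j.isLt hb) le_rfl hq]
  exact hout j p hp

/-! ## §2 The free-seam glue lies in `𝒞_Xs(k, h, W)` -/

/-- ★★ **THE FREE-SEAM GLUE THEOREM IN ONE CURRENCY**: at an admissible history (`k ≤ K`), the glue of an inner lift of `W` on `Ω_k(h)` (`InnerLiftT3`) and an outer part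
(`OuterPartT3`) that is ALSO (67)-large in recording currency (`large67RecSet`) lies in `𝒞_Xs(k, h, W)` — ✓ `glue_mem_adaptedClassT3X` supplies the seam-blind small loops, the
read-local (68) set and the charged clauses; §1 supplies the recording-currency (67) conjunct. [cite: Balaban1985UV3, (42) p.266 + (67)–(68) p.273; Balaban1985Variational, (11)–(13) pp.279–280] -/
theorem AlphaInputsT3AC.glue_mem_adaptedClassT3Xs {k : ℕ} (hk : k ≤ K) {h : Hist (F.P K) k}
    (hh : Hist.Admissible 𝔠.lane.carrier.M₁ (rcolOf (T3Scales F γ hγ (hγ1.trans (sq_min_one_le _ 𝔠.gamma0_pos)) K) 𝔠.lane.carrier) k h)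
    {W : GaugeField (F.P K) k (Matrix.specialUnitaryGroup (Fin 2) ℂ)} {U_in U_out : GaugeField (F.P K) 0 (Matrix.specialUnitaryGroup (Fin 2) ℂ)}
    (hin : AlphaInputsT3AC.InnerLiftT3 F 𝔠 γ hγ hγ1 K k h W U_in) (hout : AlphaInputsT3AC.OuterPartT3 F 𝔠 γ hγ hγ1 K k h U_out)
    (hrec : U_out ∈ AlphaInputsT3AC.large67RecSet F 𝔠 γ hγ hγ1 K k h) :
    AlphaInputsT3AC.glueT3 F 𝔠 γ hγ hγ1 K k h U_in U_out ∈ AlphaInputsT3AC.adaptedClassT3Xs F 𝔠 γ hγ hγ1 K k h W := by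
  obtain ⟨hS, hR, -, hrel⟩ := AlphaInputsT3AC.glue_mem_adaptedClassT3X (hγ1 := hγ1) hk hh hin hout
  exact ⟨hS, hR, AlphaInputsT3AC.glue_mem_large67RecSet (hγ1 := hγ1) hk hh hrec, hrel⟩

/-! ## §3 Non-emptiness of `𝒞_Xs(k, h, W)` from the parts -/

/-- **`𝒞_Xs(k, h, W) ≠ ∅` FROM THE PARTS** at an admissible history (`k ≤ K`): given an outer part `U_out` with GLOBAL seam-blind small loops (`localSmallT3X`) and
recording-currency (67)-largeness, and — when `W` is charged — an inner lift `U_in` of `W` on `Ω_k(h)`: charged ⇒ the glue is a member (§2); uncharged ⇒ `U_out` itself is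
(the charged clauses are vacuous). [cite: Balaban1985UV3, (40)–(42) p.266 + (67)–(68) p.273] -/
theorem AlphaInputsT3AC.adaptedClassT3Xs_nonempty_of_parts {k : ℕ} (hk : k ≤ K) {h : Hist (F.P K) k}
    (hh : Hist.Admissible 𝔠.lane.carrier.M₁ (rcolOf (T3Scales F γ hγ (hγ1.trans (sq_min_one_le _ 𝔠.gamma0_pos)) K) 𝔠.lane.carrier) k h)
    (W : GaugeField (F.P K) k (Matrix.specialUnitaryGroup (Fin 2) ℂ)) {U_out : GaugeField (F.P K) 0 (Matrix.specialUnitaryGroup (Fin 2) ℂ)}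
    (hout : AlphaInputsT3AC.OuterPartT3 F 𝔠 γ hγ hγ1 K k h U_out) (hloc : U_out ∈ AlphaInputsT3AC.localSmallT3X F 𝔠 γ hγ hγ1 K k h)
    (hrec : U_out ∈ AlphaInputsT3AC.large67RecSet F 𝔠 γ hγ hγ1 K k h)
    (hin : ChargedT3 F γ 𝔠.b₀ 𝔠.p₀ (avgWindowFactor F.L) K 𝔠.lane.carrier.M₁
        (rcolOf (T3Scales F γ hγ (hγ1.trans (sq_min_one_le _ 𝔠.gamma0_pos)) K) 𝔠.lane.carrier) k h W →
      ∃ U_in : GaugeField (F.P K) 0 (Matrix.specialUnitaryGroup (Fin 2) ℂ), AlphaInputsT3AC.InnerLiftT3 F 𝔠 γ hγ hγ1 K k h W U_in) :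
    (AlphaInputsT3AC.adaptedClassT3Xs F 𝔠 γ hγ hγ1 K k h W).Nonempty := by
  by_cases hW : ChargedT3 F γ 𝔠.b₀ 𝔠.p₀ (avgWindowFactor F.L) K 𝔠.lane.carrier.M₁
      (rcolOf (T3Scales F γ hγ (hγ1.trans (sq_min_one_le _ 𝔠.gamma0_pos)) K) 𝔠.lane.carrier) k h W
  · obtain ⟨U_in, hU_in⟩ := hin hW
    exact ⟨_, AlphaInputsT3AC.glue_mem_adaptedClassT3Xs (hγ1 := hγ1) hk hh hU_in hout hrec⟩
  · exact ⟨U_out, hloc, hout.2.1, hrec, fun hc => absurd hc hW⟩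

/-! ## §4 The knit: `InClassSelT3Xs` from (EL) and outer parts read in both currencies -/

/-- ★★★ **THE ONE-CURRENCY IN-CLASS SELECTION FROM INNER EXACT LIFTS AND OUTER PARTS READ IN BOTH CURRENCIES.**  For a MEASURABLE trivial-history family `Ut`: (EL)
`InnerExactLiftT3` (an inner exact regular lift of every charged datum on `Ω_k(h)`, ✓ from the fine lifts under the record sizes) and (OPR) «at every admissible non-trivial `(k, h)`,
`k ≤ K`, some finest-lattice field is an outer part (`OuterPartT3`), has seam-blind small loops at ALL read bonds (`localSmallT3X`), and is (67)-large in RECORDING currency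
(`large67RecSet`)» ⟹ `∃ UkH, InClassSelT3Xs F 𝔠 γ hγ hγ1 K Ut UkH` with `UkH k h W` an argmin of the Wilson action over `𝒞_Xs(k, h, W)` at every admissible non-trivial `(k, h, W)`
(§3 + ✓ `exists_inClassSelT3Xs_of_nonempty_univ`).  HONEST: selection∕gluing; (EL), (OPR) displayed; the argmin is not claimed to be print's minimiser.
[cite: Balaban1985UV3, (42) p.266 + (67)–(68) p.273; Balaban1985Variational, (11)–(13) pp.279–280 and Thm 1 (8) p.279] -/
theorem AlphaInputsT3AC.exists_inClassSelT3Xs_of_innerLift_of_outerPartsRec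
    (Ut : (k : ℕ) → GaugeField (F.P K) k (Matrix.specialUnitaryGroup (Fin 2) ℂ) → GaugeField (F.P K) 0 (Matrix.specialUnitaryGroup (Fin 2) ℂ))
    (hUt : ∀ k, Measurable (Ut k)) (hEL : AlphaInputsT3AC.InnerExactLiftT3 F 𝔠 γ hγ hγ1 K)
    (hOPR : ∀ (k : ℕ), k ≤ K → ∀ (h : Hist (F.P K) k),
      Hist.Admissible 𝔠.lane.carrier.M₁ (rcolOf (T3Scales F γ hγ (hγ1.trans (sq_min_one_le _ 𝔠.gamma0_pos)) K) 𝔠.lane.carrier) k h →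
      h ≠ Hist.triv (F.P K) k → ∃ U : GaugeField (F.P K) 0 (Matrix.specialUnitaryGroup (Fin 2) ℂ),
        AlphaInputsT3AC.OuterPartT3 F 𝔠 γ hγ hγ1 K k h U ∧ U ∈ AlphaInputsT3AC.localSmallT3X F 𝔠 γ hγ hγ1 K k h ∧
          U ∈ AlphaInputsT3AC.large67RecSet F 𝔠 γ hγ hγ1 K k h) :
    ∃ UkH : (k : ℕ) → Hist (F.P K) k → GaugeField (F.P K) k (Matrix.specialUnitaryGroup (Fin 2) ℂ) →
        GaugeField (F.P K) 0 (Matrix.specialUnitaryGroup (Fin 2) ℂ),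
      AlphaInputsT3AC.InClassSelT3Xs F 𝔠 γ hγ hγ1 K Ut UkH ∧
      ∀ (k : ℕ), k ≤ K → ∀ (h : Hist (F.P K) k),
        Hist.Admissible 𝔠.lane.carrier.M₁ (rcolOf (T3Scales F γ hγ (hγ1.trans (sq_min_one_le _ 𝔠.gamma0_pos)) K) 𝔠.lane.carrier) k h →
        h ≠ Hist.triv (F.P K) k → ∀ (W : GaugeField (F.P K) k (Matrix.specialUnitaryGroup (Fin 2) ℂ)),
          UkH k h W ∈ AlphaInputsT3AC.adaptedClassT3Xs F 𝔠 γ hγ hγ1 K k h W ∧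
          IsMinOn (fun U : GaugeField (F.P K) 0 (Matrix.specialUnitaryGroup (Fin 2) ℂ) => wilsonAction4 U)
            (AlphaInputsT3AC.adaptedClassT3Xs F 𝔠 γ hγ hγ1 K k h W) (UkH k h W) :=
  AlphaInputsT3AC.exists_inClassSelT3Xs_of_nonempty_univ (𝔠 := 𝔠) (hγ := hγ) (hγ1 := hγ1) Ut hUt fun k hk h hh ht W => by
    obtain ⟨U_out, hout, hloc, hrec⟩ := hOPR k hk h hh ht
    exact AlphaInputsT3AC.adaptedClassT3Xs_nonempty_of_parts (hγ1 := hγ1) hk hh W hout hloc hrec fun hW => hEL k hk h hh ht W hW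

/-! ## §5 (OPR) from the enlarged-region profile, modulo its recording-currency largeness (U2) -/

/-- **(OPR) FROM THE ENLARGED-REGION PROFILE MODULO (U2)**: under the collar row (N2′) `CollarE … K` and `4π ≤ C68`, at every admissible non-trivial history the profile `profE … h hX`
(`X ≠ 0` in `su(2)`) is an outer part (✓ `outerPartT3_profE_of_collar` with (R3P) ✓ `profileReg68LevelsT3_of_collar`), has seam-blind small loops at all read bonds
(✓ `profE_mem_localSmallT3_of_collar`, `localSmallT3 ⊆ localSmallT3X`), and — DISPLAYED hypothesis (U2), ★w4-19936's located row — is (67)-large in RECORDING currency.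
[cite: Balaban1985UV3, (67)–(68) p.273; Balaban1987RG1, (0.4) p.253] -/
theorem AlphaInputsT3AC.outerPartsRec_of_collar_of_profRec
    (hN2 : CollarE (T3Scales F γ hγ (hγ1.trans (sq_min_one_le _ 𝔠.gamma0_pos)) K) 𝔠 K) (hC : 4 * Real.pi ≤ 𝔠.C68)
    (hU2 : ∀ (k : ℕ), k ≤ K → ∀ (h : Hist (F.P K) k),
      Hist.Admissible 𝔠.lane.carrier.M₁ (rcolOf (T3Scales F γ hγ (hγ1.trans (sq_min_one_le _ 𝔠.gamma0_pos)) K) 𝔠.lane.carrier) k h →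
      ∀ (X : Matrix (Fin 2) (Fin 2) ℂ) (hX : X ∈ (suGroupModel 2).lie), X ≠ 0 →
        profE (T3Scales F γ hγ (hγ1.trans (sq_min_one_le _ 𝔠.gamma0_pos)) K) 𝔠 h hX ∈ AlphaInputsT3AC.large67RecSet F 𝔠 γ hγ hγ1 K k h) :
    ∀ (k : ℕ), k ≤ K → ∀ (h : Hist (F.P K) k),
      Hist.Admissible 𝔠.lane.carrier.M₁ (rcolOf (T3Scales F γ hγ (hγ1.trans (sq_min_one_le _ 𝔠.gamma0_pos)) K) 𝔠.lane.carrier) k h →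
      h ≠ Hist.triv (F.P K) k → ∃ U : GaugeField (F.P K) 0 (Matrix.specialUnitaryGroup (Fin 2) ℂ),
        AlphaInputsT3AC.OuterPartT3 F 𝔠 γ hγ hγ1 K k h U ∧ U ∈ AlphaInputsT3AC.localSmallT3X F 𝔠 γ hγ hγ1 K k h ∧
          U ∈ AlphaInputsT3AC.large67RecSet F 𝔠 γ hγ hγ1 K k h := by
  intro k hk h hh _
  obtain ⟨X, hX, hX0⟩ := BalabanUVNodesN08AlphaProfileGroupSU.exists_ne_zero_mem_lie_su (N := 2) le_rfl
  exact ⟨_, AlphaInputsT3AC.outerPartT3_profE_of_collar (hγ1 := hγ1) hN2 hC hk hh hX hX0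
      (AlphaInputsT3AC.profileReg68LevelsT3_of_collar (hγ1 := hγ1) hN2 k hk h hh X hX hX0),
    AlphaInputsT3AC.localSmallT3_subset_localSmallT3X k h (AlphaInputsT3AC.profE_mem_localSmallT3_of_collar (hγ1 := hγ1) hN2 hk h hX hX0),
    hU2 k hk h hh X hX hX0⟩

/-- ★★★ **THE ONE-CURRENCY IN-CLASS SELECTION FROM (EL), THE COLLAR ROW, `4π ≤ C68`, AND (U2).**  For a measurable trivial-history family `Ut`: (EL) `InnerExactLiftT3`, (N2′)
`CollarE … K`, `4π ≤ C68`, and (U2) «the profile is (67)-large in recording currency at every admissible history» ⟹ `∃ UkH, InClassSelT3Xs F 𝔠 γ hγ hγ1 K Ut UkH` with the argmin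
property over `𝒞_Xs` — the Sel∕Xs display's selection row reduced to the (FL)-chain input (EL), two constants side conditions, and ONE located kinematic row (U2).
[cite: Balaban1985UV3, (40)–(42) p.266 + (67)–(68) p.273; Balaban1985Variational, (11)–(13) pp.279–280 and Thm 1 (8) p.279] -/
theorem AlphaInputsT3AC.exists_inClassSelT3Xs_of_innerLift_of_collar_of_profRec
    (Ut : (k : ℕ) → GaugeField (F.P K) k (Matrix.specialUnitaryGroup (Fin 2) ℂ) → GaugeField (F.P K) 0 (Matrix.specialUnitaryGroup (Fin 2) ℂ))
    (hUt : ∀ k, Measurable (Ut k)) (hEL : AlphaInputsT3AC.InnerExactLiftT3 F 𝔠 γ hγ hγ1 K)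
    (hN2 : CollarE (T3Scales F γ hγ (hγ1.trans (sq_min_one_le _ 𝔠.gamma0_pos)) K) 𝔠 K) (hC : 4 * Real.pi ≤ 𝔠.C68)
    (hU2 : ∀ (k : ℕ), k ≤ K → ∀ (h : Hist (F.P K) k),
      Hist.Admissible 𝔠.lane.carrier.M₁ (rcolOf (T3Scales F γ hγ (hγ1.trans (sq_min_one_le _ 𝔠.gamma0_pos)) K) 𝔠.lane.carrier) k h →
      ∀ (X : Matrix (Fin 2) (Fin 2) ℂ) (hX : X ∈ (suGroupModel 2).lie), X ≠ 0 →
        profE (T3Scales F γ hγ (hγ1.trans (sq_min_one_le _ 𝔠.gamma0_pos)) K) 𝔠 h hX ∈ AlphaInputsT3AC.large67RecSet F 𝔠 γ hγ hγ1 K k h) :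
    ∃ UkH : (k : ℕ) → Hist (F.P K) k → GaugeField (F.P K) k (Matrix.specialUnitaryGroup (Fin 2) ℂ) →
        GaugeField (F.P K) 0 (Matrix.specialUnitaryGroup (Fin 2) ℂ),
      AlphaInputsT3AC.InClassSelT3Xs F 𝔠 γ hγ hγ1 K Ut UkH ∧
      ∀ (k : ℕ), k ≤ K → ∀ (h : Hist (F.P K) k),
        Hist.Admissible 𝔠.lane.carrier.M₁ (rcolOf (T3Scales F γ hγ (hγ1.trans (sq_min_one_le _ 𝔠.gamma0_pos)) K) 𝔠.lane.carrier) k h →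
        h ≠ Hist.triv (F.P K) k → ∀ (W : GaugeField (F.P K) k (Matrix.specialUnitaryGroup (Fin 2) ℂ)),
          UkH k h W ∈ AlphaInputsT3AC.adaptedClassT3Xs F 𝔠 γ hγ hγ1 K k h W ∧
          IsMinOn (fun U : GaugeField (F.P K) 0 (Matrix.specialUnitaryGroup (Fin 2) ℂ) => wilsonAction4 U)
            (AlphaInputsT3AC.adaptedClassT3Xs F 𝔠 γ hγ hγ1 K k h W) (UkH k h W) :=
  AlphaInputsT3AC.exists_inClassSelT3Xs_of_innerLift_of_outerPartsRec (𝔠 := 𝔠) (hγ := hγ) (hγ1 := hγ1) Ut hUt hEL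
    (AlphaInputsT3AC.outerPartsRec_of_collar_of_profRec (hγ1 := hγ1) hN2 hC hU2)

end T3

end Summit.QuantumFields.YangMills.Theorems

end
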